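import Literature.Topology.CoveringSpaces.AssociatedBundle
import Literature.Topology.CoveringSpaces.AssociatedCoveringMonodromy
import HarnessLib

/-!
# Global sections of the local system `E ×_G S → X` = the `G`-fixed points of `S`
# (`H⁰` of a local system is the invariants of the monodromy; Voisin II §3.1.1)

Topic `Literature/Topology/CoveringSpaces`; sequel of `Topology/CoveringSpaces/AssociatedBundle`
(Husemoller's Thm. 8.1: cross sections of `E ×_G T → X` ↔ `G`-equivariant maps `E → T`,
`sectionEquivEquivariant`, with continuity in both directions) and of
`Topology/CoveringSpaces/AssociatedCoveringMonodromy` (the action of `π₁(X, f e₀)` on the fibre of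
`E ×_G S → X` is `s ↦ ρ(γ) • s`, `ρ = inv ∘ fundamentalGroupToMulOpposite : π₁ → G`).

SOURCES (held, read at the page). C. Voisin, *Hodge Theory and Complex Algebraic Geometry II*
(2003) [VoisinHodgeII2003] §3.1.1 (held `book:voisin2003-hodge-theory-complex-algebraic-geometry-ii`
p0088–p0090): Cor. 3.10 (local systems of stalk `G` on `X` ↔ representations `π₁(X, x) → Aut G`) with
the inverse construction (3.1) «`Γ(U, 𝒢) = {σ : π⁻¹(U) → G ∣ σ(γ·u) = ρ(γ)·σ(u), ∀ u ∈ π⁻¹(U),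
γ ∈ π₁(X, x)}`» — the sections over `U` are the equivariant locally constant functions on `π⁻¹(U)` —
and Def. 3.13 (the monodromy representation); for `U = X` and `X̃` connected these functions are the
CONSTANT maps to `π₁`-invariant elements: `H⁰(X, 𝒢) = G^{π₁(X,x)}`. D. Husemoller, *Fibre Bundles*
(3rd ed. 1994) [Husemoller1994] Ch. 4 §8 Thm. 8.1 (sections ↔ equivariant maps).
A. Hatcher, *Algebraic Topology* (2002) [HatcherAT2002] §1.3 pp. 68–70.

THIS FILE, for a quotient covering map `f : E → X = E/G` (Mathlib `IsQuotientCoveringMap`) and a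
`G`-set `S` with the DISCRETE topology:

* §1 equivariant continuous maps from a PRECONNECTED `E` to `S` are constant, with value a
  `G`-fixed point (`eq_const_of_continuous`, `apply_mem_fixedPoints_of_equivariant`);
* §2 `flatSection hf a` — the global section `[e] ↦ [(e, a)]` through a fixed point `a ∈ S^G`
  (`flatSection_apply`, `assocProj_flatSection`, `continuous_flatSection`);
* §3 ★ `continuousSectionEquivFixedPoints` — **continuous global sections of `E ×_G S → X` ≃
  fixed points `S^G`** (`E` preconnected, nonempty): Voisin's (3.1) at `U = X`; every continuous
  section is a `flatSection` (`exists_eq_flatSection`), two continuous sections agreeing at one point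
  coincide (`section_eq_of_apply_eq`), a continuous section through `[(e₀, s)]` exists iff `s ∈ S^G`
  (`exists_section_through_iff`), there is a continuous section iff `S^G ≠ ∅`
  (`nonempty_section_iff`);
* §4 ★ `mem_fixedPoints_iff_forall_monodromy_eq` — for `E` PATH connected, **`s ∈ S^G` iff the
  point `[(e₀, s)]` of the fibre is fixed by the monodromy of every loop** (`H⁰ =` monodromy
  invariants, through the surjection `π₁(X, f e₀) → G`);
* §5 trivial actions: if `G` acts trivially on `S` then `E ×_G S ≃ₜ X × S` over `X`
  (`trivialHomeomorph`), and conversely (`E` preconnected) if every point of `E ×_G S` lies on a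
  continuous section then `G` acts trivially (`smul_eq_self_of_forall_exists_section`).

Everything is proved; the definitions (`flatSection`, `continuousSectionEquivFixedPoints`,
`trivialMap`, `trivialHomeomorph`) have bodies; no named facts, no instances. The functorial
incarnation (a local system as a functor `Π₁(S) ⥤ ModuleCat R`, global sections = monodromy
invariants: `LocalSystem.range_flatSectionsEval_eq_invariants`) is the tree's
`AlgebraicGeometry/Motives/LocalSystems`; the present file is the covering-space incarnation
`E ×_G S` used by Deligne's family (`QuadraticForm/PosComplexStructuresLatticeLocalSystem`).

## References

* [VoisinHodgeII2003] C. Voisin, *Hodge Theory and Complex Algebraic Geometry II*, CUP 2003,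
  §3.1.1, Cor. 3.10, (3.1), Def. 3.13.
* [Husemoller1994] D. Husemoller, *Fibre Bundles*, 3rd ed., GTM 20, Springer 1994, Ch. 4 §8 Thm. 8.1.
* [HatcherAT2002] A. Hatcher, *Algebraic Topology*, CUP 2002, §1.3 pp. 68–70.
-/

noncomputable section

open Set Function MulAction Topology

namespace Literature.Topology.CoveringSpaces

namespace AssocCovering

universe u v w

variable {G : Type u} {E : Type v} {X : Type*} [Group G] [MulAction G E]
  [TopologicalSpace E] [TopologicalSpace X] {f : E → X}
  {S : Type w} [MulAction G S] [TopologicalSpace S] [DiscreteTopology S]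

/-! ### §1 Equivariant continuous maps from a connected space to a discrete `G`-set -/

omit [MulAction G E] [MulAction G S] [TopologicalSpace X] in
/-- A continuous map from a preconnected space to a discrete space is constant.
[cite: VoisinHodgeII2003, §3.1.1 (3.1)] -/
theorem eq_const_of_continuous [PreconnectedSpace E] {φ : E → S} (hφc : Continuous φ) (e₀ : E) :
    φ = fun _ ↦ φ e₀ :=
  funext fun e ↦ PreconnectedSpace.constant ‹PreconnectedSpace E› hφc (x := e) (y := e₀)

omit [TopologicalSpace X] in
/-- **An equivariant continuous map from a preconnected `G`-space to a discrete `G`-set takes values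
in the fixed points**: `g • φ(e₀) = φ(g • e₀) = φ(e₀)` («`σ(γ·u) = ρ(γ)·σ(u)`» with `σ` constant).
[cite: VoisinHodgeII2003, §3.1.1 (3.1)] -/
theorem apply_mem_fixedPoints_of_equivariant [PreconnectedSpace E] {φ : E → S}
    (hφ : ∀ (g : G) (e : E), φ (g • e) = g • φ e) (hφc : Continuous φ) (e₀ : E) :
    φ e₀ ∈ fixedPoints G S := fun g ↦ by
  rw [← hφ, PreconnectedSpace.constant ‹PreconnectedSpace E› hφc (x := g • e₀) (y := e₀)]

omit [TopologicalSpace E] [TopologicalSpace X] [TopologicalSpace S] [DiscreteTopology S]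
  [MulAction G E] in
/-- A constant map with value a fixed point is equivariant. [cite: VoisinHodgeII2003, §3.1.1 (3.1)] -/
theorem equivariant_const [SMul G E] (a : fixedPoints G S) (g : G) (e : E) :
    (fun _ : E ↦ (a : S)) (g • e) = g • (fun _ : E ↦ (a : S)) e :=
  (a.2 g).symm

variable (hf : IsQuotientCoveringMap f G)
include hf

/-! ### §2 The flat section through a fixed point -/

/-- **The flat (locally constant) global section `[e] ↦ [(e, a)]` of `E ×_G S → X` through a fixed
point `a ∈ S^G`** (well defined exactly because `a` is fixed: `[(g • e, a)] = [(e, g⁻¹ • a)] = [(e, a)]`;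
Husemoller's `s_φ` for the constant equivariant map `φ ≡ a`).
[cite: VoisinHodgeII2003, §3.1.1 (3.1)] [cite: Husemoller1994, Ch. 4 §8 Thm. 8.1] -/
def flatSection (a : fixedPoints G S) : X → AssocSpace G E S :=
  sectionOfEquivariant hf fun _ : E ↦ (a : S)

omit [TopologicalSpace S] [DiscreteTopology S] in
/-- `flatSection a (f e) = [(e, a)]`. [cite: VoisinHodgeII2003, §3.1.1 (3.1)] -/
@[simp] theorem flatSection_apply (a : fixedPoints G S) (e : E) :
    flatSection hf a (f e) = assocMk (e, (a : S)) :=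
  sectionOfEquivariant_apply hf (equivariant_const a) e

omit [TopologicalSpace S] [DiscreteTopology S] in
/-- `flatSection a` is a section of the projection. [cite: VoisinHodgeII2003, §3.1.1 (3.1)] -/
@[simp] theorem assocProj_flatSection (a : fixedPoints G S) (x : X) :
    assocProj hf S (flatSection hf a x) = x :=
  assocProj_sectionOfEquivariant hf _ x

omit [DiscreteTopology S] in
/-- `flatSection a` is continuous. [cite: VoisinHodgeII2003, §3.1.1 (3.1)]
[cite: Husemoller1994, Ch. 4 §8 Thm. 8.1] -/
theorem continuous_flatSection (a : fixedPoints G S) : Continuous (flatSection hf a) :=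
  continuous_sectionOfEquivariant hf (equivariant_const a) continuous_const

omit [TopologicalSpace S] [DiscreteTopology S] in
/-- Distinct fixed points give distinct flat sections (`E` nonempty).
[cite: VoisinHodgeII2003, §3.1.1 (3.1)] -/
theorem flatSection_injective [Nonempty E] : Injective (flatSection hf (S := S)) := by
  intro a b h
  obtain ⟨e⟩ := ‹Nonempty E›
  have h' := congr_fun h (f e)
  rw [flatSection_apply, flatSection_apply] at h'
  exact Subtype.ext (assocMk_right_injective hf e h')

omit [TopologicalSpace S] [DiscreteTopology S] in
/-- The flat section through `a` passes through `[(e, a)]` for EVERY `e`; in particular its value in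
the fibre over `f e₀` corresponds to `a` under `assocFibreEquiv hf e₀`.
[cite: VoisinHodgeII2003, §3.1.1 (3.1)] -/
theorem assocFibreEquiv_flatSection (a : fixedPoints G S) (e₀ : E) :
    assocFibreEquiv hf e₀ ⟨flatSection hf a (f e₀), assocProj_flatSection hf a (f e₀)⟩ = a := by
  have : (⟨flatSection hf a (f e₀), assocProj_flatSection hf a (f e₀)⟩ : assocProj hf S ⁻¹' {f e₀}) =
      ⟨assocMk (e₀, (a : S)), rfl⟩ := Subtype.ext (flatSection_apply hf a e₀)
  rw [this, assocFibreEquiv_assocMk]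

/-! ### §3 Continuous sections ≃ fixed points -/

/-- **The fixed point of a continuous section** (`E` preconnected): the constant value of Husemoller's
equivariant map `φ_s : E → S` (`equivariantOfSection`), read off at any point `e`.
[cite: VoisinHodgeII2003, §3.1.1 (3.1)] [cite: Husemoller1994, Ch. 4 §8 Thm. 8.1] -/
theorem equivariantOfSection_mem_fixedPoints [PreconnectedSpace E] {s : X → AssocSpace G E S}
    (hs : ∀ x, assocProj hf S (s x) = x) (hsc : Continuous s) (e : E) :
    equivariantOfSection hf s hs e ∈ fixedPoints G S :=
  haveI : ContinuousConstSMul G S := ⟨fun _ ↦ continuous_of_discreteTopology⟩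
  apply_mem_fixedPoints_of_equivariant (equivariantOfSection_smul hf s hs)
    (continuous_equivariantOfSection hf hs hsc) e

/-- The equivariant map of a continuous section is constant (`E` preconnected).
[cite: VoisinHodgeII2003, §3.1.1 (3.1)] -/
theorem equivariantOfSection_eq [PreconnectedSpace E] {s : X → AssocSpace G E S}
    (hs : ∀ x, assocProj hf S (s x) = x) (hsc : Continuous s) (e e' : E) :
    equivariantOfSection hf s hs e = equivariantOfSection hf s hs e' :=
  haveI : ContinuousConstSMul G S := ⟨fun _ ↦ continuous_of_discreteTopology⟩
  PreconnectedSpace.constant ‹PreconnectedSpace E› (continuous_equivariantOfSection hf hs hsc)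
    (x := e) (y := e')

/-- ★ **Every continuous section of `E ×_G S → X` is the flat section through a fixed point**
(`E` preconnected): `s = flatSection a` with `a = φ_s(e)` for any `e`.
[cite: VoisinHodgeII2003, §3.1.1 Cor. 3.10, (3.1)] -/
theorem eq_flatSection [PreconnectedSpace E] {s : X → AssocSpace G E S}
    (hs : ∀ x, assocProj hf S (s x) = x) (hsc : Continuous s) (e : E) :
    s = flatSection hf ⟨equivariantOfSection hf s hs e,
      equivariantOfSection_mem_fixedPoints hf hs hsc e⟩ := by
  have h1 : equivariantOfSection hf s hs = fun _ ↦ equivariantOfSection hf s hs e :=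
    funext fun e' ↦ equivariantOfSection_eq hf hs hsc e' e
  have h2 := sectionOfEquivariant_equivariantOfSection hf s hs
  rw [h1] at h2
  exact h2.symm

/-- Existence form: every continuous section is `flatSection a` for some `a ∈ S^G` (`E`
preconnected and nonempty). [cite: VoisinHodgeII2003, §3.1.1 (3.1)] -/
theorem exists_eq_flatSection [PreconnectedSpace E] [Nonempty E] {s : X → AssocSpace G E S}
    (hs : ∀ x, assocProj hf S (s x) = x) (hsc : Continuous s) :
    ∃ a : fixedPoints G S, s = flatSection hf a :=
  ⟨_, eq_flatSection hf hs hsc (Classical.arbitrary E)⟩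

/-- ★ **`H⁰(X, E ×_G S) ≃ S^G`: continuous global sections of the local system `E ×_G S → X`
correspond bijectively to the `G`-fixed points of `S`** (`E` preconnected and nonempty), by
`s ↦ φ_s(e₀)` and `a ↦ flatSection a` — Voisin's «`Γ(U, 𝒢) = {σ : π⁻¹(U) → G ∣ σ(γ·u) =
ρ(γ)·σ(u)}`» at `U = X`. [cite: VoisinHodgeII2003, §3.1.1 Cor. 3.10, (3.1)]
[cite: Husemoller1994, Ch. 4 §8 Thm. 8.1] -/
def continuousSectionEquivFixedPoints [PreconnectedSpace E] [Nonempty E] :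
    {s : X → AssocSpace G E S // (∀ x, assocProj hf S (s x) = x) ∧ Continuous s} ≃
      fixedPoints G S where
  toFun s := ⟨equivariantOfSection hf s.1 s.2.1 (Classical.arbitrary E),
    equivariantOfSection_mem_fixedPoints hf s.2.1 s.2.2 _⟩
  invFun a := ⟨flatSection hf a, fun x ↦ assocProj_flatSection hf a x, continuous_flatSection hf a⟩
  left_inv s := Subtype.ext (eq_flatSection hf s.2.1 s.2.2 (Classical.arbitrary E)).symm
  right_inv a := by
    apply flatSection_injective hf
    exact (eq_flatSection hf (fun x ↦ assocProj_flatSection hf a x) (continuous_flatSection hf a)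
      (Classical.arbitrary E)).symm

/-- The equivalence sends `flatSection a` to `a`. [cite: VoisinHodgeII2003, §3.1.1 (3.1)] -/
@[simp] theorem continuousSectionEquivFixedPoints_symm_apply [PreconnectedSpace E] [Nonempty E]
    (a : fixedPoints G S) :
    ((continuousSectionEquivFixedPoints hf (S := S)).symm a :
      {s : X → AssocSpace G E S // (∀ x, assocProj hf S (s x) = x) ∧ Continuous s}).1 =
      flatSection hf a := rfl

/-- ★ **Unique continuation of sections**: two continuous sections of `E ×_G S → X` which agree at ONE
point agree everywhere (`E` preconnected). [cite: VoisinHodgeII2003, §3.1.1 Lemma 3.7, (3.1)] -/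
theorem section_eq_of_apply_eq [PreconnectedSpace E] {s s' : X → AssocSpace G E S}
    (hs : ∀ x, assocProj hf S (s x) = x) (hsc : Continuous s)
    (hs' : ∀ x, assocProj hf S (s' x) = x) (hsc' : Continuous s') {x₀ : X} (h : s x₀ = s' x₀) :
    s = s' := by
  obtain ⟨e₀, rfl⟩ := hf.surjective x₀
  rw [eq_flatSection hf hs hsc e₀, eq_flatSection hf hs' hsc' e₀]
  congr 2
  apply assocMk_right_injective hf (T := S) e₀
  change (assocMk (e₀, equivariantOfSection hf s hs e₀) : AssocSpace G E S) =
    assocMk (e₀, equivariantOfSection hf s' hs' e₀)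
  rw [assocMk_equivariantOfSection, assocMk_equivariantOfSection, h]

/-- ★ **A continuous section through `[(e₀, a)]` exists iff `a` is a fixed point** (`E` preconnected).
[cite: VoisinHodgeII2003, §3.1.1 (3.1)] -/
theorem exists_section_through_iff [PreconnectedSpace E] (e₀ : E) (a : S) :
    (∃ s : X → AssocSpace G E S, (∀ x, assocProj hf S (s x) = x) ∧ Continuous s ∧
        s (f e₀) = assocMk (e₀, a)) ↔ a ∈ fixedPoints G S := by
  constructor
  · rintro ⟨s, hs, hsc, he⟩
    have ha : equivariantOfSection hf s hs e₀ = a := by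
      apply assocMk_right_injective hf (T := S) e₀
      change (assocMk (e₀, equivariantOfSection hf s hs e₀) : AssocSpace G E S) = assocMk (e₀, a)
      rw [assocMk_equivariantOfSection, he]
    rw [← ha]
    exact equivariantOfSection_mem_fixedPoints hf hs hsc e₀
  · intro ha
    exact ⟨flatSection hf ⟨a, ha⟩, fun x ↦ assocProj_flatSection hf _ x, continuous_flatSection hf _,
      flatSection_apply hf ⟨a, ha⟩ e₀⟩

/-- **`E ×_G S → X` has a continuous section iff `S^G ≠ ∅`** (`E` preconnected and nonempty).
[cite: VoisinHodgeII2003, §3.1.1 (3.1)] -/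
theorem nonempty_section_iff [PreconnectedSpace E] [Nonempty E] :
    (∃ s : X → AssocSpace G E S, (∀ x, assocProj hf S (s x) = x) ∧ Continuous s) ↔
      (fixedPoints G S).Nonempty := by
  constructor
  · rintro ⟨s, hs, hsc⟩
    obtain ⟨a, -⟩ := exists_eq_flatSection hf hs hsc
    exact ⟨a, a.2⟩
  · rintro ⟨a, ha⟩
    exact ⟨flatSection hf ⟨a, ha⟩, fun x ↦ assocProj_flatSection hf _ x, continuous_flatSection hf _⟩

/-! ### §4 `H⁰` = invariants of the monodromy -/

/-- A fixed point is invariant under the monodromy of every loop: the monodromy of `γ` fixes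
`[(e₀, a)]` (it acts by `ρ(γ) •`). [cite: VoisinHodgeII2003, §3.1.1 Def. 3.13]
[cite: HatcherAT2002, §1.3 pp. 68–70] -/
theorem monodromy_eq_self_of_mem_fixedPoints (e₀ : E) {a : S} (ha : a ∈ fixedPoints G S)
    (γ : FundamentalGroup X (f e₀)) :
    (isCoveringMap_assocProj hf (S := S)).monodromy γ
        (⟨assocMk (e₀, a), rfl⟩ : assocProj hf S ⁻¹' {f e₀}) = ⟨assocMk (e₀, a), rfl⟩ :=
  (monodromy_eq_self_iff hf e₀ γ a).2 (ha _)

/-- ★ **`H⁰ =` monodromy invariants**: for `E` PATH connected, `a ∈ S^G` iff the point `[(e₀, a)]`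
of the fibre over `f e₀` is fixed by the monodromy of every loop at `f e₀` (the homomorphism
`π₁(X, f e₀) → G` is onto). [cite: VoisinHodgeII2003, §3.1.1 Cor. 3.10, Def. 3.13]
[cite: HatcherAT2002, §1.3 Prop. 1.40] -/
theorem mem_fixedPoints_iff_forall_monodromy_eq [PathConnectedSpace E] (e₀ : E) (a : S) :
    a ∈ fixedPoints G S ↔ ∀ γ : FundamentalGroup X (f e₀),
      (isCoveringMap_assocProj hf (S := S)).monodromy γ
        (⟨assocMk (e₀, a), rfl⟩ : assocProj hf S ⁻¹' {f e₀}) = ⟨assocMk (e₀, a), rfl⟩ := by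
  refine ⟨fun ha γ ↦ monodromy_eq_self_of_mem_fixedPoints hf e₀ ha γ, fun h g ↦ ?_⟩
  obtain ⟨γ, hγ⟩ := hf.fundamentalGroupToMulOpposite_surjective ⟨e₀, rfl⟩ (MulOpposite.op g⁻¹)
  have h1 := (monodromy_eq_self_iff hf e₀ γ a).1 (h γ)
  rw [hγ, MulOpposite.unop_op, inv_inv] at h1
  exact h1

/-- Equivalently: a continuous section through `[(e₀, a)]` exists iff `[(e₀, a)]` is fixed by every
monodromy (`E` path connected). [cite: VoisinHodgeII2003, §3.1.1 Cor. 3.10, (3.1)] -/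
theorem exists_section_through_iff_forall_monodromy_eq [PathConnectedSpace E] (e₀ : E) (a : S) :
    (∃ s : X → AssocSpace G E S, (∀ x, assocProj hf S (s x) = x) ∧ Continuous s ∧
        s (f e₀) = assocMk (e₀, a)) ↔
      ∀ γ : FundamentalGroup X (f e₀), (isCoveringMap_assocProj hf (S := S)).monodromy γ
        (⟨assocMk (e₀, a), rfl⟩ : assocProj hf S ⁻¹' {f e₀}) = ⟨assocMk (e₀, a), rfl⟩ := by
  rw [exists_section_through_iff hf, mem_fixedPoints_iff_forall_monodromy_eq hf]

/-! ### §5 Trivial actions and trivial local systems -/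

/-- The map `E ×_G S → X × S`, `[(e, s)] ↦ (f e, s)`, well defined when `G` acts trivially on `S`.
[cite: VoisinHodgeII2003, §3.1.1 Prop. 3.9] -/
def trivialMap (htriv : ∀ (g : G) (s : S), g • s = s) : AssocSpace G E S → X × S :=
  Quotient.lift (fun p : E × S ↦ (f p.1, p.2)) (by
    rintro a b ⟨g, rfl⟩
    exact Prod.ext (hf.map_smul g) (htriv g b.2))

omit [TopologicalSpace S] [DiscreteTopology S] in
/-- On classes: `trivialMap [(e, s)] = (f e, s)`. [cite: VoisinHodgeII2003, §3.1.1 Prop. 3.9] -/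
@[simp] theorem trivialMap_assocMk (htriv : ∀ (g : G) (s : S), g • s = s) (e : E) (s : S) :
    trivialMap hf htriv (assocMk (e, s)) = (f e, s) := rfl

omit [TopologicalSpace S] [DiscreteTopology S] in
/-- `trivialMap` lies over `X`. [cite: VoisinHodgeII2003, §3.1.1 Prop. 3.9] -/
@[simp] theorem trivialMap_fst (htriv : ∀ (g : G) (s : S), g • s = s) (q : AssocSpace G E S) :
    (trivialMap hf htriv q).1 = assocProj hf S q := by
  obtain ⟨⟨e, s⟩, rfl⟩ := surjective_assocMk q
  rfl

/-- **If `G` acts trivially on `S`, the local system is trivial: `E ×_G S ≃ₜ X × S` over `X`**,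
`[(e, s)] ↦ (f e, s)`, inverse `(x, s) ↦ flatSection s x`.
[cite: VoisinHodgeII2003, §3.1.1 Prop. 3.9, (3.1)] -/
def trivialHomeomorph (htriv : ∀ (g : G) (s : S), g • s = s) : AssocSpace G E S ≃ₜ X × S where
  toFun := trivialMap hf htriv
  invFun p := flatSection hf ⟨p.2, fun g ↦ htriv g p.2⟩ p.1
  left_inv q := by
    obtain ⟨⟨e, s⟩, rfl⟩ := surjective_assocMk q
    rw [trivialMap_assocMk]
    exact flatSection_apply hf ⟨s, fun g ↦ htriv g s⟩ e
  right_inv p := by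
    obtain ⟨x, s⟩ := p
    obtain ⟨e, rfl⟩ := hf.surjective x
    change trivialMap hf htriv (flatSection hf ⟨s, fun g ↦ htriv g s⟩ (f e)) = (f e, s)
    rw [flatSection_apply, trivialMap_assocMk]
  continuous_toFun := continuous_quot_lift _
    ((hf.isCoveringMap.continuous.comp continuous_fst).prodMk continuous_snd)
  continuous_invFun := by
    apply continuous_prod_of_discrete_right.2
    intro s
    exact continuous_flatSection hf ⟨s, fun g ↦ htriv g s⟩

/-- The trivialising homeomorphism lies over `X`. [cite: VoisinHodgeII2003, §3.1.1 Prop. 3.9] -/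
@[simp] theorem trivialHomeomorph_fst (htriv : ∀ (g : G) (s : S), g • s = s) (q : AssocSpace G E S) :
    (trivialHomeomorph hf htriv q).1 = assocProj hf S q :=
  trivialMap_fst hf htriv q

/-- On classes: `trivialHomeomorph [(e, s)] = (f e, s)`. [cite: VoisinHodgeII2003, §3.1.1 Prop. 3.9] -/
@[simp] theorem trivialHomeomorph_assocMk (htriv : ∀ (g : G) (s : S), g • s = s) (e : E) (s : S) :
    trivialHomeomorph hf htriv (assocMk (e, s)) = (f e, s) := rfl

/-- ★ Conversely, **if every point of `E ×_G S` lies on a continuous global section, `G` acts trivially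
on `S`** (`E` preconnected and nonempty). [cite: VoisinHodgeII2003, §3.1.1 (3.1)] -/
theorem smul_eq_self_of_forall_exists_section [PreconnectedSpace E] [Nonempty E]
    (h : ∀ q : AssocSpace G E S, ∃ s : X → AssocSpace G E S,
      (∀ x, assocProj hf S (s x) = x) ∧ Continuous s ∧ ∃ x, s x = q)
    (g : G) (a : S) : g • a = a := by
  obtain ⟨e₀⟩ := ‹Nonempty E›
  obtain ⟨s, hs, hsc, x, hx⟩ := h (assocMk (e₀, a))
  have hx' : x = f e₀ := by rw [← hs x, hx]; rfl
  subst hx'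
  exact ((exists_section_through_iff hf e₀ a).1 ⟨s, hs, hsc, hx⟩) g

end AssocCovering

end Literature.Topology.CoveringSpaces

end
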